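import Mathlib.Analysis.InnerProductSpace.PiL2
import Mathlib.Analysis.SpecialFunctions.Pow.Real
import HarnessLib

/-!
# NS-claims map, C01 (Otelbaev 2013), model file: the 53-dimensional truncation of the 2014
# counterexample family to Theorem 6.1

For `n ≥ 26` let `Ĥ = ℝ⁵³` with orthonormal basis `e₀,…,e₅₂`, `A eᵢ = λᵢ eᵢ`
with `λᵢ = 1 (i < 50)`, `λ₅₀ = 50`, `λ₅₁ = 2n`, `λ₅₂ = 2n+1`
(so `1 = λ₁ < λ₂ = 50 < 2n < 2n+1`, `dim G₁ = 50 ≥ 20`, `16 ≤ λ₂ ≤ 100`), and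
`L(u,v) = (u₅₁ v₅₂ / n) (e₅₁ + e₅₂)`.
Then (У.1) holds with `β = −1/2`, `C_β = 4` uniformly in `n`; (У.2), (У.4), (У.5) hold
because `L` vanishes as soon as one argument has `u₅₁ = 0` resp. `v₅₂ = 0` and
`range L ⊥ G₁`; the vector `ů = −n (e₅₁ + e₅₂)` has `‖A⁻¹ ů‖ ≤ 1`
(`θ = −1 < min(−3/4, β)`), `ů + L(ů,ů) = 0` and `‖ů‖ = n√2`, so no bound
`‖ů‖ ≤ C₁ (1 + ‖f̊‖ + ‖f̊‖^l)` with `C₁, l` independent of `n` holds.  Source of the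
construction: dxdy.ru topic 80156, post p817605 («sup», 2014-01-21); English account
Math.SE a/649373 (S. Montgomery-Smith); bib `MontgomerySmith2014Otelbaev`, `DxdyTopic80156`.
This file proves the interface-independent facts; `SoloRefuteOtelbaev2013.lean` packages them
against the typed `Literature.Claims.NS.Otelbaev2013.Theorem61` / `Theorem62`.
Axioms: `propext`, `Classical.choice`, `Quot.sound` only.
WHAT THIS IS NOT: not a claim about NS regularity or blow-up; not a claim about any author beyond
the typed locator.
-/

noncomputable section

open Real Finset

-- The summit's canonical theorem namespace repeats the summit name (single-conjunct summit).
set_option linter.dupNamespace false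

namespace Summit.NavierStokesRegularity.NavierStokesRegularity.Theorems.Otelbaev2013

/-- The model space `Ĥ = ℝ⁵³`. -/
abbrev H : Type := EuclideanSpace ℝ (Fin 53)

/-- Standard basis vector `eᵢ`. -/
abbrev e (i : Fin 53) : H := EuclideanSpace.single i (1 : ℝ)

/-- Index of `e_{2n}` in the print's numbering. -/
abbrev ia : Fin 53 := ⟨51, by omega⟩

/-- Index of `e_{2n+1}` in the print's numbering. -/
abbrev ib : Fin 53 := ⟨52, by omega⟩

/-- Index of the eigenvalue `λ₂ = 50`. -/
abbrev i50 : Fin 53 := ⟨50, by omega⟩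

variable (n : ℕ)

/-- Eigenvalues of `A`: `1` on the first 50 coordinates (`G₁`), then `50`, `2n`, `2n+1`. -/
def ev (i : Fin 53) : ℝ :=
  if i.val < 50 then 1 else if i.val = 50 then 50 else if i.val = 51 then 2 * n else 2 * n + 1

/-- `λ₅₁ = 2n`. -/
@[simp] theorem ev_ia : ev n ia = 2 * n := by simp [ev]

/-- `λ₅₂ = 2n + 1`. -/
@[simp] theorem ev_ib : ev n ib = 2 * n + 1 := by simp [ev]

/-- `λ₅₀ = 50`. -/
@[simp] theorem ev_i50 : ev n i50 = 50 := by simp [ev]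

/-- `λᵢ = 1` for `i < 50`. -/
theorem ev_of_lt {i : Fin 53} (hi : i.val < 50) : ev n i = 1 := by simp [ev, hi]

/-- All eigenvalues are `≥ 1` ((У.1), first half; (У.3)). -/
theorem one_le_ev (hn : 1 ≤ n) (i : Fin 53) : 1 ≤ ev n i := by
  unfold ev
  have : (1 : ℝ) ≤ n := by exact_mod_cast hn
  split_ifs <;> linarith

/-- The four eigenvalue levels. -/
theorem ev_values (i : Fin 53) :
    ev n i = 1 ∨ ev n i = 50 ∨ ev n i = 2 * n ∨ ev n i = 2 * n + 1 := by
  unfold ev; split_ifs <;> simp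

/-- Every eigenvalue other than `1` is `≥ 50` (so `λ₂ = 50`), for `n ≥ 26`. -/
theorem ev_ge_fifty_of_ne_one (hn : 26 ≤ n) {i : Fin 53} (h : ev n i ≠ 1) : 50 ≤ ev n i := by
  have hn' : (26 : ℝ) ≤ n := by exact_mod_cast hn
  rcases ev_values n i with h1 | h1 | h1 | h1
  · exact absurd h1 h
  all_goals linarith

/-- `λ₅₁ ≠ 1`. -/
theorem ev_ia_ne_one (hn : 1 ≤ n) : ev n ia ≠ 1 := by
  have : (1 : ℝ) ≤ n := by exact_mod_cast hn
  rw [ev_ia]; intro h; linarith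

/-- `λ₅₂ ≠ 1`. -/
theorem ev_ib_ne_one (hn : 1 ≤ n) : ev n ib ≠ 1 := by
  have : (1 : ℝ) ≤ n := by exact_mod_cast hn
  rw [ev_ib]; intro h; linarith

/-- `λ₅₁ ≠ λ₅₂`. -/
theorem ev_ia_ne_ev_ib : ev n ia ≠ ev n ib := by
  rw [ev_ia, ev_ib]; intro h; linarith

/-- The diagonal action `A^s u = (λᵢ^s uᵢ)ᵢ` (real power `s`). -/
def Apow (s : ℝ) (u : H) : H := WithLp.toLp 2 fun i => (ev n i) ^ s * u i

/-- Coordinates of `A^s u`. -/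
@[simp] theorem Apow_apply (s : ℝ) (u : H) (i : Fin 53) : Apow n s u i = (ev n i) ^ s * u i := rfl

/-- `A^s` is additive. -/
theorem Apow_add (s : ℝ) (u v : H) : Apow n s (u + v) = Apow n s u + Apow n s v := by
  ext i; simp [mul_add]

/-- `A^s` on a multiple of a basis vector. -/
theorem Apow_e (s c : ℝ) (i : Fin 53) : Apow n s (c • e i) = ((ev n i) ^ s * c) • e i := by
  ext j
  simp only [Apow_apply, PiLp.smul_apply, smul_eq_mul, PiLp.single_apply]
  by_cases h : j = i
  · subst h; simp
  · simp [h]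

/-- `A^s` on the plane spanned by `e₅₁, e₅₂`. -/
theorem Apow_two_coords (s a b : ℝ) :
    Apow n s (a • e ia + b • e ib) =
      ((ev n ia) ^ s * a) • e ia + ((ev n ib) ^ s * b) • e ib := by
  rw [Apow_add, Apow_e, Apow_e]

/-- The bilinear form `L(u,v) = (u₅₁ v₅₂ / n)(e₅₁ + e₅₂)`. -/
def L (u v : H) : H := (u ia * v ib / n) • (e ia + e ib)

/-- `L` is additive in the first argument. -/
theorem L_add_left (u u' v : H) : L n (u + u') v = L n u v + L n u' v := by
  simp only [L, PiLp.add_apply, ← add_smul]; ring_nf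

/-- `L` is additive in the second argument. -/
theorem L_add_right (u v v' : H) : L n u (v + v') = L n u v + L n u v' := by
  simp only [L, PiLp.add_apply, ← add_smul]; ring_nf

/-- `L` is homogeneous in the first argument. -/
theorem L_smul_left (c : ℝ) (u v : H) : L n (c • u) v = c • L n u v := by
  simp only [L, PiLp.smul_apply, smul_eq_mul, smul_smul]; ring_nf

/-- `L` is homogeneous in the second argument. -/
theorem L_smul_right (c : ℝ) (u v : H) : L n u (c • v) = c • L n u v := by
  simp only [L, PiLp.smul_apply, smul_eq_mul, smul_smul]; ring_nf

/-- `L(u,v) = 0` as soon as `u₅₁ = 0`. -/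
theorem L_eq_zero_of_left {u : H} (hu : u ia = 0) (v : H) : L n u v = 0 := by simp [L, hu]

/-- `L(u,v) = 0` as soon as `v₅₂ = 0`. -/
theorem L_eq_zero_of_right (u : H) {v : H} (hv : v ib = 0) : L n u v = 0 := by simp [L, hv]

/-- Coordinates of `L(u,v)` vanish off `{51, 52}`. -/
theorem L_apply_of_ne (u v : H) {i : Fin 53} (ha : i ≠ ia) (hb : i ≠ ib) : L n u v i = 0 := by
  simp [L, ha, hb]

/-- `range L ⊥ w` whenever `w₅₁ = w₅₂ = 0`. -/
theorem inner_L_eq_zero (u v : H) {w : H} (ha : w ia = 0) (hb : w ib = 0) :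
    inner ℝ (L n u v) w = 0 := by
  simp [L, inner_smul_left, inner_add_left, EuclideanSpace.inner_single_left, ha, hb]

/-- The witness `ů = −n (e₅₁ + e₅₂)`. -/
def uo : H := -((n : ℝ) • (e ia + e ib))

/-- `ů₅₁ = −n`. -/
@[simp] theorem uo_ia : uo n ia = -(n : ℝ) := by simp [uo]

/-- `ů₅₂ = −n`. -/
@[simp] theorem uo_ib : uo n ib = -(n : ℝ) := by simp [uo]

/-- `f(ů) = ů + L(ů,ů) = 0`. -/
theorem uo_add_L_uo (hn : 1 ≤ n) : uo n + L n (uo n) (uo n) = 0 := by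
  have hn' : (n : ℝ) ≠ 0 := by exact_mod_cast (by omega : n ≠ 0)
  rw [L, uo_ia, uo_ib, show (-(n : ℝ)) * (-(n : ℝ)) / n = n by field_simp]
  simp [uo]

/-- `ů` in the basis. -/
theorem uo_eq : uo n = (-(n : ℝ)) • e ia + (-(n : ℝ)) • e ib := by
  simp only [uo, smul_add, neg_add, neg_smul]

/-- Norm of a combination of the two distinct basis vectors `e₅₁, e₅₂`. -/
theorem norm_two_coords (a b : ℝ) :
    ‖a • e ia + b • e ib‖ = Real.sqrt (a ^ 2 + b ^ 2) := by
  rw [EuclideanSpace.norm_eq]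
  congr 1
  have : ∀ i : Fin 53, ‖(a • e ia + b • e ib) i‖ ^ 2 =
      (if i = ia then a ^ 2 else 0) + (if i = ib then b ^ 2 else 0) := by
    intro i
    by_cases ha : i = ia
    · subst ha; simp
    · by_cases hb : i = ib
      · subst hb; simp
      · simp [ha, hb]
  simp_rw [this]
  rw [sum_add_distrib, sum_ite_eq', sum_ite_eq']
  simp

/-- `‖ů‖ = n √2`. -/
theorem norm_uo : ‖uo n‖ = n * Real.sqrt 2 := by
  rw [uo_eq, norm_two_coords]
  rw [show (-(n : ℝ)) ^ 2 + (-(n : ℝ)) ^ 2 = (n : ℝ) ^ 2 * 2 by ring,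
    Real.sqrt_mul (sq_nonneg _), Real.sqrt_sq (Nat.cast_nonneg n)]

/-- The weak estimate: `‖A⁻¹ ů‖ ≤ 1` (`θ = −1`, `C_θ = 1`). -/
theorem norm_Apow_neg_one_uo (hn : 1 ≤ n) : ‖Apow n (-1) (uo n)‖ ≤ 1 := by
  have hn' : (0 : ℝ) < n := by exact_mod_cast hn
  rw [uo_eq, Apow_two_coords, ev_ia, ev_ib, Real.rpow_neg_one, Real.rpow_neg_one, norm_two_coords]
  have h1 : (((2 : ℝ) * n)⁻¹ * -(n : ℝ)) ^ 2 = 1 / 4 := by field_simp; ring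
  have h2 : (((2 : ℝ) * n + 1)⁻¹ * -(n : ℝ)) ^ 2 ≤ 1 / 4 := by
    rw [show (((2 : ℝ) * n + 1)⁻¹ * -(n : ℝ)) ^ 2 = (n : ℝ) ^ 2 / (2 * n + 1) ^ 2 by
      field_simp]
    rw [div_le_iff₀ (by positivity)]
    nlinarith
  calc Real.sqrt ((((2 : ℝ) * n)⁻¹ * -(n : ℝ)) ^ 2 +
        (((2 : ℝ) * n + 1)⁻¹ * -(n : ℝ)) ^ 2)
      ≤ Real.sqrt 1 := Real.sqrt_le_sqrt (by linarith)
    _ = 1 := Real.sqrt_one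

/-- `‖L(u,v)‖ = √2 |u₅₁ v₅₂| / n`. -/
theorem norm_L (hn : 1 ≤ n) (u v : H) : ‖L n u v‖ = Real.sqrt 2 * |u ia * v ib| / n := by
  have hn' : (0 : ℝ) < n := by exact_mod_cast hn
  rw [L, norm_smul, show (e ia + e ib : H) = (1 : ℝ) • e ia + (1 : ℝ) • e ib by simp,
    norm_two_coords, Real.norm_eq_abs, abs_div, abs_of_pos hn', one_pow, one_add_one_eq_two]
  ring

/-- `|u₅₁| ≤ √(2n) ‖A^{-1/2} u‖`. -/
theorem abs_ia_le (hn : 1 ≤ n) (u : H) :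
    |u ia| ≤ Real.sqrt (2 * n) * ‖Apow n (-1 / 2 : ℝ) u‖ := by
  have hn' : (0 : ℝ) < n := by exact_mod_cast hn
  have h := PiLp.norm_apply_le (Apow n (-1 / 2 : ℝ) u) ia
  rw [Apow_apply, ev_ia, Real.norm_eq_abs, abs_mul,
    abs_of_pos (Real.rpow_pos_of_pos (by positivity) _)] at h
  have hs : Real.sqrt (2 * n) * (2 * n : ℝ) ^ (-1 / 2 : ℝ) = 1 := by
    rw [Real.sqrt_eq_rpow, ← Real.rpow_add (by positivity)]
    norm_num
  calc |u ia| = Real.sqrt (2 * n) * ((2 * n : ℝ) ^ (-1 / 2 : ℝ) * |u ia|) := by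
        rw [← mul_assoc, hs, one_mul]
    _ ≤ Real.sqrt (2 * n) * ‖Apow n (-1 / 2 : ℝ) u‖ :=
        mul_le_mul_of_nonneg_left h (Real.sqrt_nonneg _)

/-- `|v₅₂| ≤ √(2n+1) ‖A^{-1/2} v‖`. -/
theorem abs_ib_le (hn : 1 ≤ n) (v : H) :
    |v ib| ≤ Real.sqrt (2 * n + 1) * ‖Apow n (-1 / 2 : ℝ) v‖ := by
  have hn' : (0 : ℝ) < n := by exact_mod_cast hn
  have h := PiLp.norm_apply_le (Apow n (-1 / 2 : ℝ) v) ib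
  rw [Apow_apply, ev_ib, Real.norm_eq_abs, abs_mul,
    abs_of_pos (Real.rpow_pos_of_pos (by positivity) _)] at h
  have hs : Real.sqrt (2 * n + 1) * (2 * n + 1 : ℝ) ^ (-1 / 2 : ℝ) = 1 := by
    rw [Real.sqrt_eq_rpow, ← Real.rpow_add (by positivity)]
    norm_num
  calc |v ib| = Real.sqrt (2 * n + 1) * ((2 * n + 1 : ℝ) ^ (-1 / 2 : ℝ) * |v ib|) := by
        rw [← mul_assoc, hs, one_mul]
    _ ≤ Real.sqrt (2 * n + 1) * ‖Apow n (-1 / 2 : ℝ) v‖ :=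
        mul_le_mul_of_nonneg_left h (Real.sqrt_nonneg _)

/-- **(У.1), second half** with `β = −1/2`, `C_β = 4`, uniformly in `n`:
`‖L(u,v)‖ ≤ 4 ‖A^{-1/2} u‖ ‖A^{-1/2} v‖`. -/
theorem norm_L_le (hn : 1 ≤ n) (u v : H) :
    ‖L n u v‖ ≤ 4 * ‖Apow n (-1 / 2 : ℝ) u‖ * ‖Apow n (-1 / 2 : ℝ) v‖ := by
  have hn' : (1 : ℝ) ≤ n := by exact_mod_cast hn
  rw [norm_L n hn, abs_mul]
  have ha := abs_ia_le n hn u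
  have hb := abs_ib_le n hn v
  set X := ‖Apow n (-1 / 2 : ℝ) u‖
  set Y := ‖Apow n (-1 / 2 : ℝ) v‖
  have hX : 0 ≤ X := norm_nonneg _
  have hY : 0 ≤ Y := norm_nonneg _
  have hprod : |u ia| * |v ib| ≤ Real.sqrt (2 * n) * Real.sqrt (2 * n + 1) * (X * Y) := by
    calc |u ia| * |v ib| ≤ (Real.sqrt (2 * n) * X) * (Real.sqrt (2 * n + 1) * Y) :=
          mul_le_mul ha hb (abs_nonneg _) (by positivity)
      _ = Real.sqrt (2 * n) * Real.sqrt (2 * n + 1) * (X * Y) := by ring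
  have hkey : Real.sqrt 2 * (Real.sqrt (2 * n) * Real.sqrt (2 * n + 1)) ≤ 4 * n := by
    rw [← Real.sqrt_mul (by norm_num), ← Real.sqrt_mul (by positivity)]
    rw [show (4 : ℝ) * n = Real.sqrt ((4 * n) ^ 2) by rw [Real.sqrt_sq (by positivity)]]
    exact Real.sqrt_le_sqrt (by nlinarith)
  rw [div_le_iff₀ (by positivity)]
  calc Real.sqrt 2 * (|u ia| * |v ib|)
      ≤ Real.sqrt 2 * (Real.sqrt (2 * n) * Real.sqrt (2 * n + 1) * (X * Y)) :=
        mul_le_mul_of_nonneg_left hprod (Real.sqrt_nonneg _)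
    _ = (Real.sqrt 2 * (Real.sqrt (2 * n) * Real.sqrt (2 * n + 1))) * (X * Y) := by ring
    _ ≤ (4 * n) * (X * Y) := mul_le_mul_of_nonneg_right hkey (by positivity)
    _ = 4 * X * Y * n := by ring

/-- **(У.2) for the model**: `L(u,u) = 0` whenever the non-zero coordinates of `u` all carry one
eigenvalue (then `u₅₁ = 0` or `u₅₂ = 0`, since `λ₅₁ ≠ λ₅₂`). -/
theorem L_self_eq_zero_of_eigen {u : H} {lam : ℝ}
    (h : ∀ i : Fin 53, u i ≠ 0 → ev n i = lam) : L n u u = 0 := by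
  by_cases ha : u ia = 0
  · exact L_eq_zero_of_left n ha u
  by_cases hb : u ib = 0
  · exact L_eq_zero_of_right n u hb
  exact absurd ((h ia ha).trans (h ib hb).symm) (ev_ia_ne_ev_ib n)

/-- **The dimension-free bound fails**: for every `C₁` and `l` there is `n ≥ 26` such that the
witness violates `‖ů‖ ≤ C₁ (1 + ‖f̊‖ + ‖f̊‖^l)` (`f̊ = 0`, so the right side is
`C₁ (1 + 0^l) ≤ 2|C₁|`, while `‖ů‖ = n√2`). -/
theorem exists_violation (C₁ l : ℝ) :
    ∃ n : ℕ, 26 ≤ n ∧ ¬ (‖uo n‖ ≤ C₁ * (1 + ‖uo n + L n (uo n) (uo n)‖ +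
      ‖uo n + L n (uo n) (uo n)‖ ^ l)) := by
  obtain ⟨m, hm⟩ := exists_nat_gt (2 * |C₁|)
  refine ⟨max m 26, le_max_right _ _, ?_⟩
  set n := max m 26 with hn_def
  have hn : 1 ≤ n := le_trans (by norm_num) (le_max_right m 26)
  have hmn : (m : ℝ) ≤ n := by exact_mod_cast le_max_left m 26
  rw [uo_add_L_uo n hn, norm_zero, norm_uo]
  intro h
  have hl : (0 : ℝ) ^ l ≤ 1 := by
    rcases eq_or_ne l 0 with hl0 | hl0
    · rw [hl0, Real.rpow_zero]
    · rw [Real.zero_rpow hl0]; exact zero_le_one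
  have h0l : 0 ≤ (0 : ℝ) ^ l := Real.rpow_nonneg le_rfl l
  have h2 : 1 ≤ Real.sqrt 2 := by
    rw [show (1 : ℝ) = Real.sqrt 1 from Real.sqrt_one.symm]
    exact Real.sqrt_le_sqrt (by norm_num)
  have hn0 : (0 : ℝ) ≤ n := Nat.cast_nonneg _
  have hA : C₁ * (1 + 0 + (0 : ℝ) ^ l) ≤ 2 * |C₁| :=
    calc C₁ * (1 + 0 + (0 : ℝ) ^ l) ≤ |C₁| * (1 + 0 + (0 : ℝ) ^ l) :=
          mul_le_mul_of_nonneg_right (le_abs_self _) (by linarith)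
      _ ≤ |C₁| * 2 := mul_le_mul_of_nonneg_left (by linarith) (abs_nonneg _)
      _ = 2 * |C₁| := by ring
  have hB : (n : ℝ) ≤ n * Real.sqrt 2 := le_mul_of_one_le_right hn0 h2
  linarith

end Summit.NavierStokesRegularity.NavierStokesRegularity.Theorems.Otelbaev2013

end
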